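import Summits.AtomisticToContinuum.HydrodynamicLimit.Theses.BoxDissipativeWeakStrong
import Summits.AtomisticToContinuum.HydrodynamicLimit.Theorems.AnnealedZeroHorizonMeanFluxClosureDeviatoricStressClosure
import Summits.AtomisticToContinuum.HydrodynamicLimit.Theorems.BoxDissipativeWeakStrongFluxClosureBoxIntegrableAlongFlow
import Summits.AtomisticToContinuum.HydrodynamicLimit.Theorems.BoxDissipativeWeakStrongFluxClosureBoxStreamingSplit
import Summits.AtomisticToContinuum.HydrodynamicLimit.Theorems.BoxDissipativeWeakStrongFluxClosureBoxAverageFlightDeriv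
import Summits.AtomisticToContinuum.HydrodynamicLimit.Theorems.RelayRaceLocalityNearConstantShortTimeHLMeansNecessaryStatic
import Summits.AtomisticToContinuum.HydrodynamicLimit.Theorems.RelayRaceLocalityNearConstantShortTimeHLMeansNecessaryTools
import HarnessLib

/-!
# Crux `FluxClosure` (stmt-AtomisticToContinuum-9902, route BoxDissipativeWeakStrong), line `registered`
# (= birth r3): what the open stub K (`stub_kineticIsotropy`) asserts, and its uniform `L¹(P_N)` tightness

Support file (`--supports stmt-AtomisticToContinuum-9902`) of the continuation lead of the crux
`Summit.AtomisticToContinuum.HydrodynamicLimit.Theses.BoxDissipativeWeakStrong.FluxClosure`. After the previous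
lead's landings (B1–B5, the exact split `FluxClosureGlue.boxMomentumBalance`, and the glue
`FluxClosureGlue.stub_fluxClosureOfLimitStubs : K-sig → V-sig → FluxClosure`, p150403) the crux is exactly the
conjunction of its two open limit stubs. This file records, kernel-checked, two facts about the kinetic stub K
(`KinDev_N → 0` in `L¹(P_N)`):

* `kinIntegrand_eq_stress_sub_ideal`, `kinIntegrand_eq_traceless` — for EVERY nonnegative one-body weight `χ`
  (in the crux: the cube kernel `K_ℓ(x, ·)`), configuration and test field, the integrand of K,
  `Σ_ij (Ŝ_ij − m̂_im̂_j/ρ̂ − δ_ij ρ̂θ̂) ∂_jφ_i` (`Ŝ = ∫ χ v⊗v dμ_emp`, `θ̂ = ⅔(Ê/ρ̂ − |m̂|²/2ρ̂²)`, real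
  division), IS the traceless part of the weighted peculiar velocity covariance
  `P_ij = n⁻¹Σ_a χ(q_a)(v_a^i − û_i)(v_a^j − û_j)` (`û = m̂/ρ̂`) contracted with `∇φ`: K is, verbatim, isotropy of
  the box second velocity moments along the deterministic flow, space–time averaged against `∇w` (the exact
  Reynolds/trace identity of `DeviatoricStressClosure.stress_sub_idealStress_eq_deviatoric`, freed from the
  translation form `k(x − ·)` of the weight);
* `abs_integral_kinIntegrand_le`, `abs_kinDev_le`, `lintegral_kinDev_le`, `kineticIsotropy_tight` — the
  pathwise bound `|∫_x (K-integrand) dx| ≤ 19 C (N+1)⁻¹Σ_a‖v_a‖²` (`C = sup|∂_jw_i|` on `[0,τ] × 𝕋³`, cube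
  kernel of unit mass), energy conservation on the good set, and the Gaussian velocity law of the local Gibbs
  state give, in the crux's frame and for EVERY `N`, window `0 < ℓ_N ≤ 1`, flow, `σ ≤ 1/2`:
  `∫⁻ |KinDev_N| dP_N ≤ 19 C τ (3 sup θ₀ + sup‖u₀‖²)`. So the `L¹(P_N)` norms in K are uniformly bounded
  (tight); the stub is the genuine `O(1) → o(1)` statement, and its content is the positive-time relaxation,
  for which no theorem exists (Spohn 1991, Part I §3.3; Olla–Varadhan–Yau 1993 need noise;
  `Literature.Barriers.AtomisticToContinuum.BoltzmannHypothesisBarrierNarrow`).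

No definitions. References: H. Spohn, *Large Scale Dynamics of Interacting Particles* (1991), Part I §2.3,
§3.2–3.3.
-/

noncomputable section

namespace Summit.AtomisticToContinuum.HydrodynamicLimit.Theorems
namespace FluxClosureK

open scoped BigOperators Topology Classical MeasureTheory ProbabilityTheory InnerProductSpace ENNReal
open Filter Set Function MeasureTheory
open Literature.MathematicalPhysics.KineticTheory Literature.Analysis.FluidPDE Literature.Analysis.FunctionSpaces
open DeviatoricStressClosure NearConstantShortTimeHL

variable {n : ℕ}

/-! ### The integrand of K is the traceless weighted peculiar covariance tested with `∇φ` -/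

/-- The weighted second velocity moments against the empirical measure are the averages
`n⁻¹ Σ_a χ(q_a) v_a^i v_a^j`. [folklore] -/
theorem integral_weight_mul_vel_mul_vel (c : Config n (Fin 3) T3) (χ : T3 → ℝ) (i j : Fin 3) :
    ∫ y, χ y.1 * (y.2 i * y.2 j) ∂(empiricalMeasure c) = (n : ℝ)⁻¹ * ∑ a, χ (c a).1 * ((c a).2 i * (c a).2 j) :=
  integral_empiricalMeasure c _

/-- A weight `χ` read at the particles is the translate-form weight `u ↦ χ(x − u)` read at `x − q_a`
(`x − (x − q) = q`); this frees the `DeviatoricStressClosure` identities from the form `k(x − ·)`. [folklore] -/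
theorem weight_eq_translate (χ : T3 → ℝ) (x : T3) : χ = fun y => (fun u => χ (x - u)) (x - y) := by
  funext y
  simp only [sub_sub_cancel]

/-- **The integrand of K, rearranged**: `Σ_ij (Ŝ_ij − m̂_im̂_j/ρ̂ − δ_ij ρ̂θ̂) ∂_jφ_i` equals the weighted
kinetic stress tested with `∇φ` minus the ideal Euler stress of the weighted fields tested with `∇φ`
(`Σ_ij (m̂_im̂_j/ρ̂) ∂_jφ_i + ρ̂θ̂ div φ`). Pure algebra, every weight. [folklore] -/
theorem kinIntegrand_eq_stress_sub_ideal (c : Config n (Fin 3) T3) (x : T3) (χ : T3 → ℝ) (φ : T3 → V3) :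
    ∑ i, ∑ j, ((∫ y, χ y.1 * (y.2 i * y.2 j) ∂(empiricalMeasure c)) -
        empiricalMomentumField c χ i * empiricalMomentumField c χ j / empiricalDensityField c χ -
        (if i = j then empiricalDensityField c χ * (2 / 3 * (empiricalEnergyField c χ / empiricalDensityField c χ -
          ‖empiricalMomentumField c χ‖ ^ 2 / (2 * empiricalDensityField c χ ^ 2))) else 0)) *
        Torus.partialDeriv j (fun y => φ y i) x =
      (n : ℝ)⁻¹ * ∑ a, χ (c a).1 * (∑ i, ∑ j, (c a).2 i * (c a).2 j * Torus.partialDeriv j (fun y => φ y i) x) -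
        ((∑ i, ∑ j, (empiricalMomentumField c χ i * empiricalMomentumField c χ j / empiricalDensityField c χ) *
            Torus.partialDeriv j (fun y => φ y i) x) +
          empiricalDensityField c χ * (2 / 3 * (empiricalEnergyField c χ / empiricalDensityField c χ -
            ‖empiricalMomentumField c χ‖ ^ 2 / (2 * empiricalDensityField c χ ^ 2))) * Torus.divergence φ x) := by
  set R : ℝ := empiricalDensityField c χ with hR
  set Mv : V3 := empiricalMomentumField c χ with hMv
  set En : ℝ := empiricalEnergyField c χ with hEn
  set Q : ℝ := R * (2 / 3 * (En / R - ‖Mv‖ ^ 2 / (2 * R ^ 2))) with hQ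
  have hT : (n : ℝ)⁻¹ * ∑ a, χ (c a).1 * (∑ i, ∑ j, (c a).2 i * (c a).2 j *
      Torus.partialDeriv j (fun y => φ y i) x) =
      ∑ i, ∑ j, ((n : ℝ)⁻¹ * ∑ a, χ (c a).1 * ((c a).2 i * (c a).2 j)) *
        Torus.partialDeriv j (fun y => φ y i) x := by
    simp only [Finset.mul_sum, Finset.sum_mul]
    rw [Finset.sum_comm]
    refine Finset.sum_congr rfl fun i _ => ?_
    rw [Finset.sum_comm]
    exact Finset.sum_congr rfl fun j _ => Finset.sum_congr rfl fun a _ => by ring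
  have hdiv : Q * Torus.divergence φ x =
      ∑ i, ∑ j, (if i = j then Q else 0) * Torus.partialDeriv j (fun y => φ y i) x := by
    simp only [Torus.divergence, Finset.mul_sum, ite_mul, zero_mul, Finset.sum_ite_eq, Finset.mem_univ,
      if_true]
  rw [hT, hdiv, ← Finset.sum_add_distrib, ← Finset.sum_sub_distrib]
  refine Finset.sum_congr rfl fun i _ => ?_
  rw [← Finset.sum_add_distrib, ← Finset.sum_sub_distrib]
  refine Finset.sum_congr rfl fun j _ => ?_
  rw [integral_weight_mul_vel_mul_vel, ← add_mul, ← sub_mul]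
  ring

/-- **The integrand of K is the traceless weighted peculiar covariance contracted with `∇φ`.** For every
configuration `c`, point `x`, weight `χ ≥ 0` and field `φ`:
`Σ_ij (Ŝ_ij − m̂_im̂_j/ρ̂ − δ_ij ρ̂θ̂) ∂_jφ_i(x) = Σ_ij (P_ij − δ_ij tr P/3) ∂_jφ_i(x)`,
`P_ij = n⁻¹Σ_a χ(q_a)(v_a^i − m̂_i/ρ̂)(v_a^j − m̂_j/ρ̂)` (all fields weighted by `χ`; `tr P = 3ρ̂θ̂`; at `ρ̂ = 0`
every weight vanishes and both sides are `0`). With `χ = K_ℓ(x, ·)` this is the integrand of the crux's stub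
`stub_kineticIsotropy` at `(t, z, x)`: K asserts isotropy of the box second velocity moments, space–time
averaged against `∇w`, in `L¹(P_N)`. [folklore] -/
theorem kinIntegrand_eq_traceless (c : Config n (Fin 3) T3) (x : T3) {χ : T3 → ℝ} (hχ : ∀ y, 0 ≤ χ y)
    (φ : T3 → V3) :
    ∑ i, ∑ j, ((∫ y, χ y.1 * (y.2 i * y.2 j) ∂(empiricalMeasure c)) -
        empiricalMomentumField c χ i * empiricalMomentumField c χ j / empiricalDensityField c χ -
        (if i = j then empiricalDensityField c χ * (2 / 3 * (empiricalEnergyField c χ / empiricalDensityField c χ -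
          ‖empiricalMomentumField c χ‖ ^ 2 / (2 * empiricalDensityField c χ ^ 2))) else 0)) *
        Torus.partialDeriv j (fun y => φ y i) x =
      ∑ i, ∑ j, ((n : ℝ)⁻¹ * ∑ a, χ (c a).1 *
          (((c a).2 i - empiricalMomentumField c χ i / empiricalDensityField c χ) *
            ((c a).2 j - empiricalMomentumField c χ j / empiricalDensityField c χ)) -
        (if i = j then 1 else 0) *
          ((∑ l, (n : ℝ)⁻¹ * ∑ a, χ (c a).1 *
            (((c a).2 l - empiricalMomentumField c χ l / empiricalDensityField c χ) *
              ((c a).2 l - empiricalMomentumField c χ l / empiricalDensityField c χ))) / 3)) *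
        Torus.partialDeriv j (fun y => φ y i) x := by
  have hR : empiricalDensityField c χ = empiricalDensityField c (fun y => (fun u => χ (x - u)) (x - y)) := by
    rw [← weight_eq_translate χ x]
  have hMv : empiricalMomentumField c χ = empiricalMomentumField c (fun y => (fun u => χ (x - u)) (x - y)) := by
    rw [← weight_eq_translate χ x]
  have hEn : empiricalEnergyField c χ = empiricalEnergyField c (fun y => (fun u => χ (x - u)) (x - y)) := by
    rw [← weight_eq_translate χ x]
  have h := stressIntegrand_sub_idealIntegrand_eq c x (k := fun u => χ (x - u)) (fun y => hχ _) φ hR hMv hEn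
  simp only [sub_sub_cancel] at h
  rw [kinIntegrand_eq_stress_sub_ideal, h]

/-! ### Pathwise bounds: the K functional is dominated by the kinetic energy -/

/-- **Pointwise bound**: for a weight `χ ≥ 0` and `|∂_jφ_i| ≤ C`, the integrand of K at `x` is at most
`19 C · n⁻¹Σ_a χ(q_a)‖v_a‖²` in absolute value (`9C` from the kinetic stress, `20C · Ê` from the ideal
stress, `Ê = ½ n⁻¹Σ_a χ(q_a)‖v_a‖²`). [folklore] -/
theorem abs_kinIntegrand_le (c : Config n (Fin 3) T3) (x : T3) {χ : T3 → ℝ} (hχ : ∀ y, 0 ≤ χ y)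
    {φ : T3 → V3} {C : ℝ} (hC : ∀ i j y, |Torus.partialDeriv j (fun y => φ y i) y| ≤ C) :
    |∑ i, ∑ j, ((∫ y, χ y.1 * (y.2 i * y.2 j) ∂(empiricalMeasure c)) -
        empiricalMomentumField c χ i * empiricalMomentumField c χ j / empiricalDensityField c χ -
        (if i = j then empiricalDensityField c χ * (2 / 3 * (empiricalEnergyField c χ / empiricalDensityField c χ -
          ‖empiricalMomentumField c χ‖ ^ 2 / (2 * empiricalDensityField c χ ^ 2))) else 0)) *
        Torus.partialDeriv j (fun y => φ y i) x| ≤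
      19 * C * ((n : ℝ)⁻¹ * ∑ a, χ (c a).1 * ‖(c a).2‖ ^ 2) := by
  have hR : empiricalDensityField c χ = empiricalDensityField c (fun y => (fun u => χ (x - u)) (x - y)) := by
    rw [← weight_eq_translate χ x]
  have hMv : empiricalMomentumField c χ = empiricalMomentumField c (fun y => (fun u => χ (x - u)) (x - y)) := by
    rw [← weight_eq_translate χ x]
  have hEn : empiricalEnergyField c χ = empiricalEnergyField c (fun y => (fun u => χ (x - u)) (x - y)) := by
    rw [← weight_eq_translate χ x]
  have hc : 0 ≤ (n : ℝ)⁻¹ := inv_nonneg.2 (Nat.cast_nonneg n)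
  have h1 := abs_stressIntegrand_le c x (k := fun u => χ (x - u)) (fun y => hχ _) hC hc
  have h2 := abs_idealIntegrand_le c x (k := fun u => χ (x - u)) (fun y => hχ _) hC hR hMv hEn
  simp only [sub_sub_cancel] at h1
  have hE : empiricalEnergyField c χ = (n : ℝ)⁻¹ * ∑ a, χ (c a).1 * (‖(c a).2‖ ^ 2 / 2) :=
    empiricalEnergyField_eq_sum c χ
  have hE' : 20 * C * empiricalEnergyField c χ = 10 * C * ((n : ℝ)⁻¹ * ∑ a, χ (c a).1 * ‖(c a).2‖ ^ 2) := by
    rw [hE, Finset.mul_sum, Finset.mul_sum, Finset.mul_sum, Finset.mul_sum]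
    exact Finset.sum_congr rfl fun a _ => by ring
  rw [kinIntegrand_eq_stress_sub_ideal]
  calc _ ≤ |(n : ℝ)⁻¹ * ∑ a, χ (c a).1 * (∑ i, ∑ j, (c a).2 i * (c a).2 j * Torus.partialDeriv j (fun y => φ y i) x)| +
        |(∑ i, ∑ j, (empiricalMomentumField c χ i * empiricalMomentumField c χ j / empiricalDensityField c χ) *
            Torus.partialDeriv j (fun y => φ y i) x) +
          empiricalDensityField c χ * (2 / 3 * (empiricalEnergyField c χ / empiricalDensityField c χ -
            ‖empiricalMomentumField c χ‖ ^ 2 / (2 * empiricalDensityField c χ ^ 2))) * Torus.divergence φ x| :=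
        abs_sub _ _
    _ ≤ 9 * C * ((n : ℝ)⁻¹ * ∑ a, χ (c a).1 * ‖(c a).2‖ ^ 2) + 20 * C * empiricalEnergyField c χ :=
        add_le_add h1 h2
    _ = 19 * C * ((n : ℝ)⁻¹ * ∑ a, χ (c a).1 * ‖(c a).2‖ ^ 2) := by rw [hE']; ring

/-- The cube kernel has unit mass in its CENTRE variable as well: `∫ K_ℓ(x, q) dx = 1` (`0 < ℓ ≤ 1`;
symmetry `K_ℓ(x, q) = K_ℓ(q, x)` and `LGFS.integral_boxK_right`). [folklore] -/
theorem integral_boxK_left {l : ℝ} (hl : 0 < l) (hl1 : l ≤ 1) (q : T3) :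
    ∫ x : T3, Set.indicator {y' : T3 | ∀ i, ‖y' i - x i‖ < l / 2} (fun _ => (l ^ 3)⁻¹) q = 1 := by
  simp_rw [FluxClosureB3.boxK_symm l _ q]
  exact LGFS.integral_boxK_right hl hl1 q

/-- **Space-integrated bound at a frozen configuration** (cube kernel `K_ℓ(x, ·)` as the weight, `0 < ℓ ≤ 1`,
`|∂_jφ_i| ≤ C`): `|∫_x Σ_ij (Ŝ − m̂⊗m̂/ρ̂ − δρ̂θ̂)_ij ∂_jφ_i dx| ≤ 19 C · n⁻¹Σ_a‖v_a‖²` (integrate the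
pointwise bound; the kernel has unit mass in `x`; no integrability of the integrand is needed). [folklore] -/
theorem abs_integral_kinIntegrand_le (c : Config n (Fin 3) T3) {l : ℝ} (hl : 0 < l) (hl1 : l ≤ 1)
    {φ : T3 → V3} {C : ℝ} (hC : ∀ i j y, |Torus.partialDeriv j (fun y => φ y i) y| ≤ C) :
    |∫ x : T3, ∑ i, ∑ j, ((∫ y, Set.indicator {y' : T3 | ∀ i, ‖y' i - x i‖ < l / 2} (fun _ => (l ^ 3)⁻¹) y.1 *
          (y.2 i * y.2 j) ∂(empiricalMeasure c)) -
        empiricalMomentumField c (fun y => Set.indicator {y' : T3 | ∀ i, ‖y' i - x i‖ < l / 2} (fun _ => (l ^ 3)⁻¹) y) i *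
          empiricalMomentumField c (fun y => Set.indicator {y' : T3 | ∀ i, ‖y' i - x i‖ < l / 2} (fun _ => (l ^ 3)⁻¹) y) j /
          empiricalDensityField c (fun y => Set.indicator {y' : T3 | ∀ i, ‖y' i - x i‖ < l / 2} (fun _ => (l ^ 3)⁻¹) y) -
        (if i = j then
          empiricalDensityField c (fun y => Set.indicator {y' : T3 | ∀ i, ‖y' i - x i‖ < l / 2} (fun _ => (l ^ 3)⁻¹) y) *
            (2 / 3 * (empiricalEnergyField c (fun y => Set.indicator {y' : T3 | ∀ i, ‖y' i - x i‖ < l / 2} (fun _ => (l ^ 3)⁻¹) y) /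
              empiricalDensityField c (fun y => Set.indicator {y' : T3 | ∀ i, ‖y' i - x i‖ < l / 2} (fun _ => (l ^ 3)⁻¹) y) -
              ‖empiricalMomentumField c (fun y => Set.indicator {y' : T3 | ∀ i, ‖y' i - x i‖ < l / 2} (fun _ => (l ^ 3)⁻¹) y)‖ ^ 2 /
                (2 * empiricalDensityField c (fun y => Set.indicator {y' : T3 | ∀ i, ‖y' i - x i‖ < l / 2} (fun _ => (l ^ 3)⁻¹) y) ^ 2)))
        else 0)) * Torus.partialDeriv j (fun y => φ y i) x| ≤
      19 * C * ((n : ℝ)⁻¹ * ∑ a, ‖(c a).2‖ ^ 2) := by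
  have hKint : ∀ a : Fin n, Integrable (fun x : T3 =>
      Set.indicator {y' : T3 | ∀ i, ‖y' i - x i‖ < l / 2} (fun _ => (l ^ 3)⁻¹) (c a).1) := fun a =>
    (integrable_const ((l ^ 3)⁻¹)).mono' (FluxClosureB2.measurable_boxK_left l (c a).1).aestronglyMeasurable
      (ae_of_all _ fun x => FluxClosureB2.norm_boxK_le hl.le x (c a).1)
  have hg : Integrable (fun x : T3 => 19 * C * ((n : ℝ)⁻¹ * ∑ a,
      Set.indicator {y' : T3 | ∀ i, ‖y' i - x i‖ < l / 2} (fun _ => (l ^ 3)⁻¹) (c a).1 * ‖(c a).2‖ ^ 2)) :=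
    ((integrable_finsetSum _ fun a _ => (hKint a).mul_const _).const_mul _).const_mul _
  rw [← Real.norm_eq_abs]
  refine (norm_integral_le_of_norm_le hg (ae_of_all _ fun x => ?_)).trans_eq ?_
  · rw [Real.norm_eq_abs]
    exact abs_kinIntegrand_le c x (fun y => LGFS.boxK_nonneg hl.le x y) hC
  · rw [integral_const_mul, integral_const_mul, integral_finsetSum _ (fun a _ => (hKint a).mul_const _)]
    congr 1
    congr 1
    refine Finset.sum_congr rfl fun a _ => ?_
    rw [integral_mul_const, integral_boxK_left hl hl1 (c a).1, one_mul]

/-! ### Uniform bounds on the derivatives of the test field on `[0, τ] × 𝕋³` -/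

/-- For `w` smooth on the slab `[0,T) × 𝕋³` and `τ < T`, all space derivatives `∂_jw_i` are bounded on
`[0, τ] × 𝕋³` by one constant `C ≥ 0` (compactness, through `FluxClosureB4.exists_measurable_fderiv`). [folklore] -/
theorem exists_forall_abs_partialDeriv_le_slab {T τ : ℝ} (hτT : τ < T) {w : ℝ → T3 → V3}
    (hw : Torus.IsSmoothSpaceTimeOn (Ico 0 T) w) :
    ∃ C : ℝ, 0 ≤ C ∧ ∀ t ∈ Icc 0 τ, ∀ (i j : Fin 3) (x : T3), |Torus.partialDeriv j (fun y => w t y i) x| ≤ C := by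
  obtain ⟨H, C, -, -, hd, hb⟩ := FluxClosureB4.exists_measurable_fderiv hτT hw
  refine ⟨max C 0, le_max_right _ _, fun t ht i j x => ?_⟩
  have htT : t ∈ Ico 0 T := ⟨ht.1, lt_of_le_of_lt ht.2 hτT⟩
  rw [hd t htT x j i]
  calc |H (t, x) (0, EuclideanSpace.single j 1) i| ≤ ‖H (t, x) (0, EuclideanSpace.single j 1)‖ := by
        rw [← Real.norm_eq_abs]
        exact PiLp.norm_apply_le _ i
    _ ≤ ‖H (t, x)‖ * ‖((0 : ℝ), EuclideanSpace.single j (1 : ℝ))‖ := ContinuousLinearMap.le_opNorm _ _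
    _ ≤ C * 1 := by
        refine mul_le_mul (hb t ht x) ?_ (norm_nonneg _) ((norm_nonneg _).trans (hb t ht x))
        rw [Prod.norm_def, norm_zero, PiLp.norm_single, norm_one, max_eq_right zero_le_one]
    _ ≤ max C 0 := by rw [mul_one]; exact le_max_left _ _

/-! ### The stub's functional is uniformly bounded in `L¹(P_N)` -/

/-- **Uniform `L¹(P_N)` tightness of the kinetic deviation (stub K of crux `FluxClosure`).** In the crux's
vocabulary (cube kernel `K`, box fields `Dn, Mm, En`, box kinetic stress `Sk`, box temperature `Th`): for
`σ ≤ 1/2`, continuous profiles `a₀, θ₀ > 0`, `u₀` with `3θ₀ + ‖u₀‖² ≤ B₁`, every flow family, every window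
`0 < ℓ_N ≤ 1`, every `τ ∈ [0, T)` and every `w` smooth on `[0,T) × 𝕋³` there is `C ≥ 0` (a bound for `|∂_jw_i|`
on `[0,τ] × 𝕋³`) with, FOR EVERY `N`,
`∫⁻ |KinDev_N| dP_N ≤ 19 C τ B₁`, `KinDev_N(z) = ∫_0^τ∫ Σ_ij (Sk − m̂⊗m̂/ρ̂ − δρ̂θ̂)_ij ∂_jw_i`.
Proof: on the good set (conull for `P_N ≪` Liouville) the space integral is at most `19 C (N+1)⁻¹Σ_a‖v_a(t)‖²`
(`abs_integral_kinIntegrand_le`), the kinetic energy is conserved, `|∫_{(0,τ]}·| ≤ τ · sup`, and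
`E_P[(N+1)⁻¹Σ_a‖v_a‖²] ≤ 3 sup θ₀ + sup‖u₀‖²` (Gaussian velocities given the positions,
`lintegral_avg_norm_sq_vel_le`). So the `L¹(P_N)` norms whose vanishing the stub `stub_kineticIsotropy` asserts
are uniformly bounded; the stub's content is the limit `→ 0` (positive-time isotropisation), not finiteness.
[folklore] -/
theorem kineticIsotropy_tight : ∀ (σ : ℝ), σ ≤ 1 / 2 → ∀ (a₀ θ₀ : T3 → ℝ) (u₀ : T3 → V3), Continuous a₀ → Continuous θ₀ → Continuous u₀ → (∀ x, 0 < a₀ x) → (∀ x, 0 < θ₀ x) → ∀ (B₁ : ℝ), (∀ x, 3 * θ₀ x + ‖u₀ x‖ ^ 2 ≤ B₁) → ∀ (T : ℝ) (Φ : (N : ℕ) → HardSphereFlow (Torus.geometry (Fin 3)) (hsDiameter σ N) (N + 1)) (ℓ : ℕ → ℝ), (∀ N, 0 < ℓ N ∧ ℓ N ≤ 1) → let K := fun (l : ℝ) (x y : T3) => indicator {y' : T3 | ∀ i, ‖y' i - x i‖ < l / 2} (fun _ => (l ^ 3)⁻¹) y; let Dn := fun N t z x => empiricalDensityField ((Φ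 N).flow t z) (K (ℓ N) x); let Mm := fun N t z x => empiricalMomentumField ((Φ N).flow t z) (K (ℓ N) x); let En := fun N t z x => empiricalEnergyField ((Φ N).flow t z) (K (ℓ N) x); let Sk := fun N t z x (i j : Fin 3) => ∫ y, K (ℓ N) x y.1 * (y.2 i * y.2 j) ∂(empiricalMeasure ((Φ N).flow t z)); let Th := fun (r : ℝ) (m : V3) (E : ℝ) => 2 / 3 * (E / r - ‖m‖ ^ 2 / (2 * r ^ 2)); ∀ τ ∈ Ico 0 T, ∀ w : ℝ → T3 → V3, Torus.IsSmoothSpaceTimeOn (Ico 0 T) w → ∃ C : ℝ, 0 ≤ C ∧ ∀ N : ℕ, ∫⁻ z, ENNReal.ofReal (|∫ t in Ioc 0 τ, ∫ x, ∑ i, ∑ j, (Sk N t z x i j - Mm N t z x i * Mm N t z x j / Dn N t z x - (if i = j then Dn N t z x * Th (Dn N t z x) (Mm N t z x) (En N t z x) else 0)) * Torus.partialDeriv j (fun y => w t y i) x|) ∂(localGibbsLaw σ a₀ u₀ θ₀ N (Φ N)) ≤ ENNReal.ofReal (19 * C * τ * B₁) := by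
  intro σ hσ a₀ θ₀ u₀ ha hθ hu ha0 hθ0 B₁ hB₁ T Φ ℓ hℓ
  dsimp only
  intro τ hτ w hw
  obtain ⟨C, hC0, hC⟩ := exists_forall_abs_partialDeriv_le_slab hτ.2 hw
  refine ⟨C, hC0, fun N => ?_⟩
  have hPac : localGibbsLaw σ a₀ u₀ θ₀ N (Φ N) ≪ liouville (Torus.geometry (Fin 3)) (N + 1) (hsDiameter σ N) :=
    particleLaw_absolutelyContinuous (Φ N) _
  have hgood : ∀ᵐ z ∂(localGibbsLaw σ a₀ u₀ θ₀ N (Φ N)), z ∈ (Φ N).good := hPac.ae_le (Φ N).ae_mem_good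
  haveI : IsProbabilityMeasure (particleLaw (Φ N) (canonicalDensity (Torus.geometry (Fin 3)) (hsDiameter σ N) (N + 1)
      (localGibbsProfile a₀ u₀ θ₀))) := isProbabilityMeasure_localGibbsLaw ha hθ hu ha0 hθ0 hσ N (Φ N)
  have hE : ∫⁻ z, ENNReal.ofReal ((((N + 1 : ℕ)) : ℝ)⁻¹ * ∑ a, ‖(z a).2‖ ^ 2) ∂(localGibbsLaw σ a₀ u₀ θ₀ N (Φ N)) ≤
      ENNReal.ofReal B₁ :=
    lintegral_avg_norm_sq_vel_le (Φ N) ha hθ hu (fun x => (ha0 x).le) hθ0 hB₁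
  have h19 : 0 ≤ 19 * C * τ := by have := hτ.1; positivity
  calc _ ≤ ∫⁻ z, ENNReal.ofReal (19 * C * τ * ((((N + 1 : ℕ)) : ℝ)⁻¹ * ∑ a, ‖(z a).2‖ ^ 2))
        ∂(localGibbsLaw σ a₀ u₀ θ₀ N (Φ N)) := by
        refine lintegral_mono_ae (hgood.mono fun z hz => ENNReal.ofReal_le_ofReal ?_)
        rw [← Real.norm_eq_abs]
        refine (norm_setIntegral_le_of_norm_le_const (C := 19 * C * ((((N + 1 : ℕ)) : ℝ)⁻¹ * ∑ a, ‖(z a).2‖ ^ 2))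
          measure_Ioc_lt_top fun t ht => ?_).trans_eq ?_
        · rw [Real.norm_eq_abs]
          refine (abs_integral_kinIntegrand_le ((Φ N).flow t z) (hℓ N).1 (hℓ N).2 (hC t ⟨ht.1.le, ht.2⟩)).trans_eq ?_
          rw [sum_norm_sq_vel_flow (Φ N) hz t]
        · rw [Real.volume_real_Ioc_of_le hτ.1, sub_zero]
          ring
    _ = ENNReal.ofReal (19 * C * τ) *
          ∫⁻ z, ENNReal.ofReal ((((N + 1 : ℕ)) : ℝ)⁻¹ * ∑ a, ‖(z a).2‖ ^ 2) ∂(localGibbsLaw σ a₀ u₀ θ₀ N (Φ N)) := by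
        rw [← lintegral_const_mul' _ _ ENNReal.ofReal_ne_top]
        refine lintegral_congr fun z => ?_
        rw [← ENNReal.ofReal_mul h19]
    _ ≤ ENNReal.ofReal (19 * C * τ) * ENNReal.ofReal B₁ := mul_le_mul_right hE _
    _ = ENNReal.ofReal (19 * C * τ * B₁) := by rw [← ENNReal.ofReal_mul h19]

end FluxClosureK
end Summit.AtomisticToContinuum.HydrodynamicLimit.Theorems

end
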